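import Summits.QuantumFields.YangMills.Theorems.BalabanLadderNTStrongCouplingPairCore
import HarnessLib

/-!
# Crux `NT` (stmt-QuantumFields-19353) / seam `UVSeamRec` (stmt-QuantumFields-20043): the conditional third cumulant as
# covariances, and its SEPARATION decay at strong coupling (toward the E3-osc rung)

Helper file of the fleet lead prover of crux `NT` (unit `ym-spine-19353-p1`, g6); first half of the strong-coupling format
rung of clause 3 of the registered stub `stub_refpkgT : RefPkgT` (v4T),

  (E3-osc)  `|kerK3_{Q,η}(x,y,z) − kerK3_{Q,η'}(x,y,z)| ≤ C₃ / (min depth)⁴ / (1 + min pairwise separation)⁸`.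

* octic conversions `half_pow_le_octic`, `half_pow_half_le_octic` (`x⁸/8! ≤ eˣ`);
* `k3_algebra`, `kerK3_eq_kerCov` — `κ₃ = kerCov(XY, Z) − kerE X · kerCov(Y, Z) − kerE Y · kerCov(X, Z)`;
  `osc_k3_algebra` — the product rule with absolute values for the five-term cumulant (plain reals);
* `abs_kerK3_le_smallBeta` — **(M1) at strong coupling** `216 · N · |β| ≤ 1`: for EVERY cube `Q`, every exterior `η` and
  every triple of sites, `|kerK3_{Q,η}(x,y,z)| ≤ 96 M³ S · 2^{−min(⌊‖z−x‖_∞⌋, ⌊‖z−y‖_∞⌋)}` — the three covariances against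
  `dens z`, each through the face-hugging sub-volume `Q ∩ {links within min − 2 of z}` (`abs_kerCov_le_of_condOsc`,
  `abs_kerInt_sub_le_of_agree_ball`).

The sibling `…NTStrongCouplingTriple` adds the DEPTH mechanism and assembles E3-osc in the registered shape.  HONEST FRAMING:
high-temperature lattice statements, every compact metrisable `G`, every lattice representation; nothing at large `β`,
nothing about NT, the seam or the gap.

References: Georgii 2011 Def. 1.23, Thm. 8.20; Dobrushin 1970 Thm. 3; Föllmer 1988 Ch. I (2.10); Simon 1979.
-/

set_option autoImplicit false

noncomputable section

open MeasureTheory Filter Topology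
open Literature.MathematicalPhysics.QuantumFieldTheory Literature.MathematicalPhysics.QuantumLattice
open Literature.Probability.LatticeModels
open Summit.QuantumFields.YangMills.Cruxes.OSLegsFromFemtoAndGap.DlrCollarTransfer
open Summit.QuantumFields.YangMills.Theorems.OSLegsFromFemtoAndGap.StubLower (norm_le_two_mul_of_forall_abs_le)

namespace Summit.QuantumFields.YangMills.Cruxes.NT.StrongCoupling

/-! ## §1 Arithmetic: the octic conversion -/

/-- `2^{−n} ≤ 40320 / ((log 2)⁸ n⁸)` for `n ≥ 1` (`x⁸/8! ≤ eˣ` at `x = n log 2`). [folklore] -/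
theorem half_pow_le_octic {n : ℕ} (hn : 1 ≤ n) : (1 / 2 : ℝ) ^ n ≤ 40320 / (Real.log 2 ^ 8 * (n : ℝ) ^ 8) := by
  have hlog : 0 < Real.log 2 := Real.log_pos (by norm_num)
  have hnpos : (0 : ℝ) < n := by exact_mod_cast hn
  have hx : 0 ≤ (n : ℝ) * Real.log 2 := by positivity
  have h := Real.pow_div_factorial_le_exp _ hx 8
  have hfac : ((Nat.factorial 8 : ℕ) : ℝ) = 40320 := by norm_num [Nat.factorial]
  have hexp : Real.exp ((n : ℝ) * Real.log 2) = 2 ^ n := by rw [Real.exp_nat_mul, Real.exp_log (by norm_num)]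
  have h2 : ((n : ℝ) * Real.log 2) ^ 8 = Real.log 2 ^ 8 * (n : ℝ) ^ 8 := by ring
  rw [hfac, hexp, h2] at h
  have hpos : (0 : ℝ) < Real.log 2 ^ 8 * (n : ℝ) ^ 8 := by positivity
  have h2n : (0 : ℝ) < 2 ^ n := by positivity
  rw [le_div_iff₀ hpos, one_div_pow, one_div_mul_eq_div, div_le_iff₀ h2n]
  rw [div_le_iff₀ (by norm_num : (0 : ℝ) < 40320)] at h
  linarith

/-- `2^{−⌊n/2⌋} ≤ 264539520 / ((log 2)⁸ n⁸)` for `n ≥ 1` (`264539520 = 40320 · 3⁸`). [folklore] -/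
theorem half_pow_half_le_octic {n : ℕ} (hn : 1 ≤ n) :
    (1 / 2 : ℝ) ^ (n / 2) ≤ 264539520 / (Real.log 2 ^ 8 * (n : ℝ) ^ 8) := by
  have hlog : 0 < Real.log 2 := Real.log_pos (by norm_num)
  have hlog1 : Real.log 2 < 1 := by
    have := Real.log_two_lt_d9; linarith
  have hnpos : (0 : ℝ) < n := by exact_mod_cast hn
  rcases Nat.lt_or_ge n 2 with h | h
  · have hn1 : n = 1 := by omega
    subst hn1
    have hl8 : Real.log 2 ^ 8 ≤ 1 := pow_le_one₀ hlog.le hlog1.le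
    rw [show (1 : ℕ) / 2 = 0 from rfl, pow_zero, le_div_iff₀ (by positivity)]
    push_cast; nlinarith
  · set m : ℕ := n / 2 with hm
    have hm1 : 1 ≤ m := by omega
    have hnm : (n : ℝ) ≤ 3 * m := by exact_mod_cast (show n ≤ 3 * m by omega)
    have hmpos : (0 : ℝ) < m := by exact_mod_cast hm1
    refine (half_pow_le_octic hm1).trans ?_
    rw [div_le_div_iff₀ (by positivity) (by positivity)]
    have h3 : (n : ℝ) ^ 8 ≤ 6561 * (m : ℝ) ^ 8 := by
      have := pow_le_pow_left₀ hnpos.le hnm 8; nlinarith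
    nlinarith [pow_pos hlog 8]

/-! ## §2 Algebra of the third cumulant -/

/-- The third cumulant from covariances: `κ₃ = cov(XY, Z) − EX · cov(Y, Z) − EY · cov(X, Z)` (plain reals). [folklore] -/
theorem k3_algebra (pXYZ pX pY pZ pXY pXZ pYZ : ℝ) :
    pXYZ - pX * pYZ - pY * pXZ - pZ * pXY + 2 * (pX * pY * pZ) =
      (pXYZ - pXY * pZ) - pX * (pYZ - pY * pZ) - pY * (pXZ - pX * pZ) := by
  ring

/-- Product rule with absolute values for the five-term cumulant (plain reals): if the seven kernel means move by at most
`u₃, u₁, u₁, u₁, u₂, u₂, u₂` (triple, singles, pairs) and are bounded by `M³, M, M, M, M², M², M²`, the cumulant moves by at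
most `u₃ + 3 (u₁ M² + M u₂) + 2 · 3 M² u₁`. [folklore] -/
theorem osc_k3_algebra {M u₁ u₂ u₃ : ℝ} (hM : 0 ≤ M) (hu₁ : 0 ≤ u₁)
    {p p' a a' b b' c c' qxy qxy' qxz qxz' qyz qyz' : ℝ}
    (hp : |p - p'| ≤ u₃) (ha : |a - a'| ≤ u₁) (hb : |b - b'| ≤ u₁) (hc : |c - c'| ≤ u₁)
    (hxy : |qxy - qxy'| ≤ u₂) (hxz : |qxz - qxz'| ≤ u₂) (hyz : |qyz - qyz'| ≤ u₂)
    (ha' : |a'| ≤ M) (hb' : |b'| ≤ M) (hc' : |c'| ≤ M) (hbM : |b| ≤ M) (hcM : |c| ≤ M)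
    (hqxy : |qxy| ≤ M * M) (hqxz : |qxz| ≤ M * M) (hqyz : |qyz| ≤ M * M) :
    |(p - a * qyz - b * qxz - c * qxy + 2 * (a * b * c)) - (p' - a' * qyz' - b' * qxz' - c' * qxy' + 2 * (a' * b' * c'))| ≤
      u₃ + 3 * (u₁ * (M * M) + M * u₂) + 6 * (M * M) * u₁ := by
  have hu₂ : 0 ≤ u₂ := (abs_nonneg _).trans hxy
  -- the three mixed products
  have hprod : ∀ {s s' q q' : ℝ}, |s - s'| ≤ u₁ → |q - q'| ≤ u₂ → |s'| ≤ M → |q| ≤ M * M →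
      |s * q - s' * q'| ≤ u₁ * (M * M) + M * u₂ := by
    intro s s' q q' hs hq hs' hqM
    have e : s * q - s' * q' = (s - s') * q + s' * (q - q') := by ring
    rw [e]
    refine (abs_add_le _ _).trans ?_
    rw [abs_mul, abs_mul]
    exact add_le_add (mul_le_mul hs hqM (abs_nonneg _) hu₁) (mul_le_mul hs' hq (abs_nonneg _) hM)
  have h1 := hprod ha hyz ha' hqyz
  have h2 := hprod hb hxz hb' hqxz
  have h3 := hprod hc hxy hc' hqxy
  -- the triple product
  have htri : |a * b * c - a' * b' * c'| ≤ 3 * (M * M) * u₁ := by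
    have e : a * b * c - a' * b' * c' = (a - a') * (b * c) + a' * ((b - b') * c) + a' * (b' * (c - c')) := by ring
    rw [e]
    have hbc : |b * c| ≤ M * M := by rw [abs_mul]; exact mul_le_mul hbM hcM (abs_nonneg _) hM
    have t1 : |(a - a') * (b * c)| ≤ u₁ * (M * M) := by
      rw [abs_mul]; exact mul_le_mul ha hbc (abs_nonneg _) hu₁
    have t2 : |a' * ((b - b') * c)| ≤ M * (u₁ * M) := by
      rw [abs_mul, abs_mul]
      exact mul_le_mul ha' (mul_le_mul hb hcM (abs_nonneg _) hu₁) (by positivity) hM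
    have t3 : |a' * (b' * (c - c'))| ≤ M * (M * u₁) := by
      rw [abs_mul, abs_mul]
      exact mul_le_mul ha' (mul_le_mul hb' hc (abs_nonneg _) hM) (by positivity) hM
    calc _ ≤ |(a - a') * (b * c) + a' * ((b - b') * c)| + |a' * (b' * (c - c'))| := abs_add_le _ _
      _ ≤ |(a - a') * (b * c)| + |a' * ((b - b') * c)| + |a' * (b' * (c - c'))| :=
          add_le_add (abs_add_le _ _) le_rfl
      _ ≤ u₁ * (M * M) + M * (u₁ * M) + M * (M * u₁) := add_le_add (add_le_add t1 t2) t3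
      _ = 3 * (M * M) * u₁ := by ring
  have e : (p - a * qyz - b * qxz - c * qxy + 2 * (a * b * c)) - (p' - a' * qyz' - b' * qxz' - c' * qxy' + 2 * (a' * b' * c')) =
      (p - p') - (a * qyz - a' * qyz') - (b * qxz - b' * qxz') - (c * qxy - c' * qxy') + 2 * (a * b * c - a' * b' * c') := by
    ring
  rw [e]
  have s1 := abs_sub (p - p') (a * qyz - a' * qyz')
  have s2 := abs_sub ((p - p') - (a * qyz - a' * qyz')) (b * qxz - b' * qxz')
  have s3 := abs_sub ((p - p') - (a * qyz - a' * qyz') - (b * qxz - b' * qxz')) (c * qxy - c' * qxy')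
  have s4 := abs_add_le ((p - p') - (a * qyz - a' * qyz') - (b * qxz - b' * qxz') - (c * qxy - c' * qxy'))
    (2 * (a * b * c - a' * b' * c'))
  have s5 : |2 * (a * b * c - a' * b' * c')| = 2 * |a * b * c - a' * b' * c'| := by
    rw [abs_mul, abs_two]
  linarith

section Main

variable (G : Type) [Group G] [TopologicalSpace G] [IsTopologicalGroup G] [CompactSpace G]
  [MeasurableSpace G] [BorelSpace G] (r : LatticeRep G)

/-- **The conditional third cumulant as conditional covariances**:
`kerK3 = kerCov(dens x · dens y, dens z) − kerE(dens x) · kerCov(dens y, dens z) − kerE(dens y) · kerCov(dens x, dens z)`.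
[folklore] -/
theorem kerK3_eq_kerCov (β : ℝ) (c : Fin 4 → ℤ) (b : ℕ) (η : LGConfig 4 G) (x y z : Fin 4 → ℤ) :
    kerK3 G r β c b η x y z =
      kerCov G r β c b η (fun U => dens G r x U * dens G r y U) (dens G r z) -
        kerE G r β c b η (dens G r x) * kerCov G r β c b η (dens G r y) (dens G r z) -
        kerE G r β c b η (dens G r y) * kerCov G r β c b η (dens G r x) (dens G r z) := by
  unfold kerK3 kerCov
  exact k3_algebra _ _ _ _ _ _ _

/-- **(M1) Separation decay of the conditional third cumulant at strong coupling.**  For `216 N |β| ≤ 1`, EVERY cube,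
every exterior and every triple of sites:
`|kerK3_{Q,η}(x, y, z)| ≤ 96 M³ S · 2^{−m}`, `m = min(⌊‖z − x‖_∞⌋, ⌊‖z − y‖_∞⌋)` — the three covariances against `dens z` of
`kerK3_eq_kerCov`, each conditioned on the face-hugging sub-volume `Q ∩ {links within m − 2 of z}` (`abs_kerCov_le_of_condOsc`,
`abs_kerInt_sub_le_of_agree_ball`). [folklore] -/
theorem abs_kerK3_le_smallBeta {β : ℝ} (hβ : 216 * (r.N : ℝ) * |β| ≤ 1) {M : ℝ}
    (hM : ∀ (w : Fin 4 → ℤ) (U : LGConfig 4 G), |dens G r w U| ≤ M) (c : Fin 4 → ℤ) (b : ℕ) (η : LGConfig 4 G)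
    (x y z : Fin 4 → ℤ) :
    |kerK3 G r β c b η x y z| ≤
      96 * M ^ 3 * r.curvature.supp.card * (1 / 2 : ℝ) ^ min ⌊‖z - x‖⌋₊ ⌊‖z - y‖⌋₊ := by
  classical
  haveI := r.t2Space
  haveI := r.secondCountableTopology
  have hM0 : 0 ≤ M := (abs_nonneg _).trans (hM 0 fun _ => 1)
  set m : ℕ := min ⌊‖z - x‖⌋₊ ⌊‖z - y‖⌋₊ with hm
  set S : ℕ := r.curvature.supp.card with hS
  have hXm := (continuous_dens r x).measurable
  have hYm := (continuous_dens r y).measurable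
  have hZm := (continuous_dens r z).measurable
  have hXYb : ∀ U, |dens G r x U * dens G r y U| ≤ M * M := fun U => by
    rw [abs_mul]; exact mul_le_mul (hM x U) (hM y U) (abs_nonneg _) hM0
  rw [kerK3_eq_kerCov]
  rcases Nat.lt_or_ge m 2 with hm2 | hm2
  · -- small separation: crude bounds
    have h1 := abs_kerCov_le_two_mul G r β c b η hXYb (hM z)
    have h2 := abs_kerCov_le_two_mul G r β c b η (hM y) (hM z)
    have h3 := abs_kerCov_le_two_mul G r β c b η (hM x) (hM z)
    have hEx := BoundaryLaw.abs_kerE_le G r β c b η (hM x)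
    have hEy := BoundaryLaw.abs_kerE_le G r β c b η (hM y)
    have hp : (1 / 4 : ℝ) ≤ (1 / 2 : ℝ) ^ m := by interval_cases m <;> norm_num
    rcases Nat.eq_zero_or_pos S with hS0 | hSpos
    · -- the density reads no link: it is constant and every covariance vanishes
      have hsupp : r.curvature.supp.image (fun e : Literature.MathematicalPhysics.QuantumLattice.ZdEdge 4 => (e.1 + z, e.2)) = ∅ := by
        rw [← Finset.card_eq_zero]; exact Nat.eq_zero_of_le_zero ((card_supp_dens_le G r z).trans hS0.le)
      have hconst : ∀ U, dens G r z U = dens G r z η := fun U => by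
        refine dependsOn_dens G r z (fun w hw => ?_)
        rw [hsupp] at hw; simp at hw
      have hzero : ∀ F : LGConfig 4 G → ℝ, kerCov G r β c b η F (dens G r z) = 0 := by
        intro F
        have hγ := BoundaryLaw.isSpecification_cubeKernels G r β
        haveI : IsProbabilityMeasure (ymSpecification (d := 4) r.ρ β (cubeEdges c b) η) := hγ.isProbability _ η
        unfold kerCov kerE
        simp_rw [hconst]
        rw [integral_mul_const, integral_const]
        simp only [probReal_univ, smul_eq_mul, one_mul, sub_self]
      rw [hzero, hzero, hzero]; simp only [mul_zero, sub_self, abs_zero]; positivity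
    · have hS1 : (1 : ℝ) ≤ S := by exact_mod_cast hSpos
      generalize kerCov G r β c b η (fun U => dens G r x U * dens G r y U) (dens G r z) = q₁ at h1 ⊢
      generalize kerCov G r β c b η (dens G r y) (dens G r z) = q₂ at h2 ⊢
      generalize kerCov G r β c b η (dens G r x) (dens G r z) = q₃ at h3 ⊢
      generalize kerE G r β c b η (dens G r x) = a at hEx ⊢
      generalize kerE G r β c b η (dens G r y) = a' at hEy ⊢
      have t : |q₁ - a * q₂ - a' * q₃| ≤ 2 * (M * M * M) + M * (2 * (M * M)) + M * (2 * (M * M)) := by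
        calc _ ≤ |q₁ - a * q₂| + |a' * q₃| := abs_sub _ _
          _ ≤ |q₁| + |a * q₂| + |a' * q₃| := add_le_add (abs_sub _ _) le_rfl
          _ ≤ _ := by
              rw [abs_mul, abs_mul]
              exact add_le_add (add_le_add h1 (mul_le_mul hEx h2 (abs_nonneg _) hM0))
                (mul_le_mul hEy h3 (abs_nonneg _) hM0)
      refine t.trans ?_
      have hM3 : 0 ≤ M * M * M := by positivity
      nlinarith [mul_nonneg hM3 (sub_nonneg.2 hS1), mul_nonneg hM3 (sub_nonneg.2 hp)]
  · -- separation `m ≥ 2`: condition on the ball of radius `m − 2` around `z` inside `Q`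
    set Λ' : Finset (Literature.MathematicalPhysics.QuantumLattice.ZdEdge 4) :=
      (cubeEdges c b).filter fun w => ⌊‖w.1 - z‖⌋₊ ≤ m - 2 with hΛ'
    have hsub : Λ' ⊆ cubeEdges c b := Finset.filter_subset _ _
    -- a link read by `dens u`, `u ∈ {x, y}`, is not in `Λ'`
    have hfar : ∀ (u : Fin 4 → ℤ), m ≤ ⌊‖z - u‖⌋₊ →
        ∀ w ∈ (r.curvature.supp.image fun e : Literature.MathematicalPhysics.QuantumLattice.ZdEdge 4 => (e.1 + u, e.2)),
          w ∉ Λ' := by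
      intro u hu w hw hwΛ
      have hw1 : ‖w.1 - u‖ ≤ (1 : ℝ) := norm_sub_le_one_of_mem_supp_dens G r hw
      have hwz : ⌊‖w.1 - z‖⌋₊ ≤ m - 2 := (Finset.mem_filter.1 hwΛ).2
      have htri : ‖z - u‖ ≤ ‖w.1 - z‖ + 1 := by
        calc ‖z - u‖ ≤ ‖z - w.1‖ + ‖w.1 - u‖ := norm_sub_le_norm_sub_add_norm_sub _ _ _
          _ ≤ ‖w.1 - z‖ + 1 := by rw [norm_sub_rev]; linarith
      have hfl : ⌊‖z - u‖⌋₊ ≤ ⌊‖w.1 - z‖⌋₊ + 1 := by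
        calc ⌊‖z - u‖⌋₊ ≤ ⌊‖w.1 - z‖ + 1⌋₊ := Nat.floor_mono htri
          _ = ⌊‖w.1 - z‖⌋₊ + 1 := Nat.floor_add_one (norm_nonneg _)
      omega
    have hAX : DependsOn (dens G r x) ((↑Λ' : Set (Literature.MathematicalPhysics.QuantumLattice.ZdEdge 4))ᶜ) :=
      (dependsOn_dens G r x).mono fun w hw hwΛ => hfar x (min_le_left _ _) w (Finset.mem_coe.1 hw) (Finset.mem_coe.1 hwΛ)
    have hAY : DependsOn (dens G r y) ((↑Λ' : Set (Literature.MathematicalPhysics.QuantumLattice.ZdEdge 4))ᶜ) :=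
      (dependsOn_dens G r y).mono fun w hw hwΛ => hfar y (min_le_right _ _) w (Finset.mem_coe.1 hw) (Finset.mem_coe.1 hwΛ)
    have hAXY : DependsOn (fun U => dens G r x U * dens G r y U)
        ((↑Λ' : Set (Literature.MathematicalPhysics.QuantumLattice.ZdEdge 4))ᶜ) := by
      intro U V h
      show dens G r x U * dens G r y U = dens G r x V * dens G r y V
      rw [hAX h, hAY h]
    -- the oscillation of the conditional mean of `dens z`
    have hosc : ∀ ζ : LGConfig 4 G, (∀ w, w ∉ cubeEdges c b → ζ w = η w) →
        |(∫ U, dens G r z U ∂(ymSpecification (d := 4) r.ρ β Λ' ζ)) -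
            ∫ U, dens G r z U ∂(ymSpecification (d := 4) r.ρ β Λ' η)| ≤ 2 * M * S * (1 / 2 : ℝ) ^ (m - 2 + 1 - 1) := by
      intro ζ hζ
      refine (abs_kerInt_sub_le_of_agree_ball G r hβ Λ' ζ η z (m - 2) (fun w hw hle => hζ w fun hwQ =>
        hw (Finset.mem_filter.2 ⟨hwQ, hle⟩)) hZm (dependsOn_dens G r z) (hM z)
        (fun w hw => floor_norm_le_one_of_mem_supp_dens G r hw)).trans ?_
      have hc : ((r.curvature.supp.image fun e : Literature.MathematicalPhysics.QuantumLattice.ZdEdge 4 =>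
          (e.1 + z, e.2)).card : ℝ) ≤ S := by exact_mod_cast card_supp_dens_le G r z
      have h0 : 0 ≤ 2 * M := by positivity
      exact mul_le_mul_of_nonneg_right (mul_le_mul_of_nonneg_left hc h0) (by positivity)
    have k1 := abs_kerCov_le_of_condOsc G r β c b η hsub (hXm.mul hYm) hZm hXYb (hM z) hAXY hosc
    have k2 := abs_kerCov_le_of_condOsc G r β c b η hsub hYm hZm (hM y) (hM z) hAY hosc
    have k3 := abs_kerCov_le_of_condOsc G r β c b η hsub hXm hZm (hM x) (hM z) hAX hosc
    have hEx := BoundaryLaw.abs_kerE_le G r β c b η (hM x)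
    have hEy := BoundaryLaw.abs_kerE_le G r β c b η (hM y)
    have hss : m - 2 + 1 - 1 = m - 2 := by omega
    rw [hss] at k1 k2 k3
    generalize kerCov G r β c b η (fun U => dens G r x U * dens G r y U) (dens G r z) = q₁ at k1 ⊢
    generalize kerCov G r β c b η (dens G r y) (dens G r z) = q₂ at k2 ⊢
    generalize kerCov G r β c b η (dens G r x) (dens G r z) = q₃ at k3 ⊢
    generalize kerE G r β c b η (dens G r x) = a at hEx ⊢
    generalize kerE G r β c b η (dens G r y) = a' at hEy ⊢
    have t : |q₁ - a * q₂ - a' * q₃| ≤ 2 * (M * M) * (2 * M * S * (1 / 2 : ℝ) ^ (m - 2)) +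
        M * (2 * M * (2 * M * S * (1 / 2 : ℝ) ^ (m - 2))) + M * (2 * M * (2 * M * S * (1 / 2 : ℝ) ^ (m - 2))) := by
      calc _ ≤ |q₁ - a * q₂| + |a' * q₃| := abs_sub _ _
        _ ≤ |q₁| + |a * q₂| + |a' * q₃| := add_le_add (abs_sub _ _) le_rfl
        _ ≤ _ := by
            rw [abs_mul, abs_mul]
            exact add_le_add (add_le_add k1 (mul_le_mul hEx k2 (abs_nonneg _) hM0)) (mul_le_mul hEy k3 (abs_nonneg _) hM0)
    refine t.trans ?_
    have h4 := half_pow_sub_two_le m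
    calc 2 * (M * M) * (2 * M * S * (1 / 2 : ℝ) ^ (m - 2)) + M * (2 * M * (2 * M * S * (1 / 2 : ℝ) ^ (m - 2))) +
          M * (2 * M * (2 * M * S * (1 / 2 : ℝ) ^ (m - 2)))
        = 12 * (M * (M * (M * S))) * (1 / 2 : ℝ) ^ (m - 2) := by ring
      _ ≤ 12 * (M * (M * (M * S))) * (4 * (1 / 2 : ℝ) ^ m) := mul_le_mul_of_nonneg_left h4 (by positivity)
      _ ≤ 96 * M ^ 3 * S * (1 / 2 : ℝ) ^ m := by
          have : 0 ≤ M * (M * (M * S)) * (1 / 2 : ℝ) ^ m := by positivity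
          nlinarith

end Main

end Summit.QuantumFields.YangMills.Cruxes.NT.StrongCoupling

end
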